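/-
Copyright: the b2b-balaban T⁴-continuum CRUX team, row NE7b OWNER lineage `t4-ne7b-p1` (gen 139). Project licence.
-/
import Summits.QuantumFields.BalabanUV.T4Continuum.Spine.NE7b.SupBlockFirstOrderLetters

/-!
# THE FIRST-ORDER KERNEL LETTERS FOR SEVERAL BLOCKS (SCOPING (d11)(1)): for a potential whose Hessian has NO CROSS-BLOCK ENTRIES
# (`U″(φ)[e_z][e_x] = 0` whenever `b z ≠ b x`, `b : ι → β` the block map — e.g. `U = Σ_B U_B` with each `U_B` local in the block `B`) and the
# operator letter `‖U″‖ ≤ κ₂`, the entrywise majorant is `Hk_{xz} = κ₂·[b x = b z]`, its rows and columns sum to at most `n·κ₂` with `n` a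
# bound on the block sizes, and (449)'s `Hd` (κ₂ on the diagonal, `Hk` off it) has row and column letters `(n+1)κ₂` — INDEPENDENT OF THE
# NUMBER OF BLOCKS, so every letter of (447)–(454) stays volume-uniform in the multi-block step ((451)'s one-block case is `b` constant on `Y`)
# (row NE7b, node U5c; (451) BY NAME; [folklore])

Cell `pub-balaban`, sub-cell `t4`, spine estimate NE7b (`T4WeightBudget.RelWeightBound`; the cell's OWN estimate — NOT PRINTED in
[Bałaban 1983–89], NOT PROVED).  Crux-route work under `Spine/NE7b/` by the row OWNER (`t4-ne7b-p1` gen 139, file (455)) under FREEZE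
(0)'s crux-prover clause; NOTHING of Bałaban's is named as a Lean object, valued or asserted; no `T4Continuum/Support` leaf typed; no
`def`, no notation; zero `sorry`.  Imports (BY NAME): the OWNER's (451) `…SupBlockFirstOrderLetters` (`first_order_cross`, `first_order_ceiling`,
`first_order_floor`).

WHAT IS PROVED ([folklore]; `b : ι → β` the block map, `n` a bound on the fibres `|{z : b z = b x}|`):
* §1 `multiblock_kernel_majorant` (`|U″(φ)[e_z][e_x]| ≤ κ₂·[b x = b z]`), **`multiblock_Hk_rowsum_le`**, `multiblock_Hk_colsum_le`
  (`Σ_z Hk_{xz} ≤ nκ₂`), **`multiblock_Hd_rowsum_le`**, **`multiblock_Hd_colsum_le`** (`≤ (n+1)κ₂`).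
* §2 the three first-order letters of (449)∕(450) for this majorant: `multiblock_cross`, `multiblock_ceiling`, `multiblock_floor`.
* §3 toy (kernel): two singleton blocks on `Fin 2` (`b = id`): the majorant is diagonal.

HONEST (what this is NOT).  Letters only; the cross-block vanishing is a HYPOTHESIS (for `U = Σ_BU_B` it is (412)'s locality block by
block — not re-derived here); the precision condition and the class map are untouched.  Scalar skeleton ((A3), NC-NE7b-α UNRULED); nothing of
Bałaban's asserted.  BY-NAME EFFECT ON THE WALL: NONE.  NE7b NOT PRINTED ∕ NOT PROVED; spine PROVED 0∕9; rung (B)+1 — the programme's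
measures remain FINITE-torus statements; NOT the mass gap, NOT Clay.  HONEST DEPENDENCY: continuum YM on T⁴ ⇐ BetaPertH ∧ nine spine
estimates (0∕9 proved); BetaPertH ⇐ (D1) ∧ (D4) ∧ CAP+tail; G-an2-4 gates asym, D1 and NE2∕3∕4.
-/

set_option autoImplicit false

noncomputable section

namespace Summit.QuantumFields.BalabanUV.T4Continuum.NE7b.SupMultiBlockFirstOrderLetters

open Real Set Finset
open scoped BigOperators
open SupBlockFirstOrderLetters (first_order_cross first_order_ceiling first_order_floor)

variable {ι : Type} [Fintype ι] [DecidableEq ι] {β : Type} [DecidableEq β]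

variable {U' : EuclideanSpace ℝ ι → EuclideanSpace ℝ ι →L[ℝ] ℝ} {U'' : EuclideanSpace ℝ ι → EuclideanSpace ℝ ι →L[ℝ] EuclideanSpace ℝ ι →L[ℝ] ℝ}
  {κ₂ : ℝ} {b : ι → β} {n : ℕ}

/-! ## §1. The multi-block majorant and its letters -/

/-- **THE MULTI-BLOCK MAJORANT**: no cross-block Hessian entries and `‖U″‖ ≤ κ₂` give `|U″(φ)[e_z][e_x]| ≤ κ₂·[b x = b z]`. [folklore] -/
theorem multiblock_kernel_majorant (hU''b : ∀ φ : EuclideanSpace ℝ ι, ‖U'' φ‖ ≤ κ₂)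
    (hcross0 : ∀ (φ : EuclideanSpace ℝ ι) (x z : ι), b z ≠ b x → U'' φ (EuclideanSpace.single z (1 : ℝ)) (EuclideanSpace.single x (1 : ℝ)) = 0)
    (φ : EuclideanSpace ℝ ι) (x z : ι) :
    |U'' φ (EuclideanSpace.single z (1 : ℝ)) (EuclideanSpace.single x (1 : ℝ))| ≤ if b x = b z then κ₂ else 0 := by
  split_ifs with h
  · have h1 : ‖U'' φ (EuclideanSpace.single z (1 : ℝ)) (EuclideanSpace.single x (1 : ℝ))‖ ≤
        ‖U'' φ (EuclideanSpace.single z (1 : ℝ))‖ * ‖EuclideanSpace.single x (1 : ℝ)‖ := ContinuousLinearMap.le_opNorm _ _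
    have h2 : ‖U'' φ (EuclideanSpace.single z (1 : ℝ))‖ ≤ ‖U'' φ‖ * ‖EuclideanSpace.single z (1 : ℝ)‖ := ContinuousLinearMap.le_opNorm _ _
    have hz : ‖EuclideanSpace.single z (1 : ℝ)‖ = 1 := by simp
    have hx : ‖EuclideanSpace.single x (1 : ℝ)‖ = 1 := by simp
    rw [hz, mul_one] at h2
    rw [hx, mul_one, Real.norm_eq_abs] at h1
    exact h1.trans (h2.trans (hU''b φ))
  · rw [hcross0 φ x z (fun e => h e.symm), abs_zero]

omit [DecidableEq ι] in
/-- **Row letter of the majorant**: `Σ_z κ₂·[b x = b z] ≤ nκ₂` when every fibre of `b` has at most `n` sites (`κ₂ ≥ 0`). [folklore] -/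
theorem multiblock_Hk_rowsum_le (hκ₂ : 0 ≤ κ₂) (hn : ∀ x, (Finset.univ.filter fun z => b x = b z).card ≤ n) (x : ι) :
    ∑ z, (if b x = b z then κ₂ else 0) ≤ n * κ₂ := by
  rw [← Finset.sum_filter, Finset.sum_const, nsmul_eq_mul]
  exact mul_le_mul_of_nonneg_right (by exact_mod_cast hn x) hκ₂

omit [DecidableEq ι] in
/-- **Column letter of the majorant**: `Σ_x κ₂·[b x = b z] ≤ nκ₂`. [folklore] -/
theorem multiblock_Hk_colsum_le (hκ₂ : 0 ≤ κ₂) (hn : ∀ x, (Finset.univ.filter fun z => b x = b z).card ≤ n) (z : ι) :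
    ∑ x, (if b x = b z then κ₂ else 0) ≤ n * κ₂ := by
  have e : ∀ x, (if b x = b z then κ₂ else (0 : ℝ)) = if b z = b x then κ₂ else 0 := fun x => by
    by_cases h : b x = b z
    · rw [if_pos h, if_pos h.symm]
    · rw [if_neg h, if_neg (fun e => h e.symm)]
  simp_rw [e]
  exact multiblock_Hk_rowsum_le hκ₂ hn z

/-- **Row letter of `Hd`** (`κ₂` at `w = x`, the majorant off it): `≤ (n+1)κ₂`. [folklore] -/
theorem multiblock_Hd_rowsum_le (hκ₂ : 0 ≤ κ₂) (hn : ∀ x, (Finset.univ.filter fun z => b x = b z).card ≤ n) (x : ι) :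
    ∑ w, (if w = x then κ₂ else if b x = b w then κ₂ else 0) ≤ (n + 1) * κ₂ := by
  calc ∑ w, (if w = x then κ₂ else if b x = b w then κ₂ else 0) ≤ ∑ w, ((if w = x then κ₂ else 0) + (if b x = b w then κ₂ else 0)) := by
        refine Finset.sum_le_sum fun w _ => ?_
        by_cases hwx : w = x <;> by_cases hb : b x = b w <;> simp [hwx, hb, hκ₂]
    _ = κ₂ + ∑ w, (if b x = b w then κ₂ else 0) := by
        rw [Finset.sum_add_distrib, Finset.sum_ite_eq' Finset.univ x, if_pos (Finset.mem_univ x)]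
    _ ≤ κ₂ + n * κ₂ := by linarith [multiblock_Hk_rowsum_le hκ₂ hn x]
    _ = (n + 1) * κ₂ := by ring

/-- **Column letter of `Hd`**: `≤ (n+1)κ₂`. [folklore] -/
theorem multiblock_Hd_colsum_le (hκ₂ : 0 ≤ κ₂) (hn : ∀ x, (Finset.univ.filter fun z => b x = b z).card ≤ n) (w : ι) :
    ∑ x, (if w = x then κ₂ else if b x = b w then κ₂ else 0) ≤ (n + 1) * κ₂ := by
  calc ∑ x, (if w = x then κ₂ else if b x = b w then κ₂ else 0) ≤ ∑ x, ((if x = w then κ₂ else 0) + (if b x = b w then κ₂ else 0)) := by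
        refine Finset.sum_le_sum fun x _ => ?_
        by_cases hxw : x = w
        · subst hxw; by_cases hb : b x = b x <;> simp [hκ₂]
        · have hwx : ¬ w = x := fun e => hxw e.symm
          by_cases hb : b x = b w <;> simp [hxw, hwx, hb]
    _ = κ₂ + ∑ x, (if b x = b w then κ₂ else 0) := by
        rw [Finset.sum_add_distrib, Finset.sum_ite_eq' Finset.univ w, if_pos (Finset.mem_univ w)]
    _ ≤ κ₂ + n * κ₂ := by linarith [multiblock_Hk_colsum_le hκ₂ hn w]
    _ = (n + 1) * κ₂ := by ring

/-! ## §2. The first-order letters of (449)∕(450) for the multi-block majorant -/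

/-- The cross letter with `H = κ₂·[b x = b z]`. [folklore] -/
theorem multiblock_cross (hU'd : ∀ φ : EuclideanSpace ℝ ι, HasFDerivAt U' (U'' φ) φ) (hU''b : ∀ φ : EuclideanSpace ℝ ι, ‖U'' φ‖ ≤ κ₂)
    (hcross0 : ∀ (φ : EuclideanSpace ℝ ι) (x z : ι), b z ≠ b x → U'' φ (EuclideanSpace.single z (1 : ℝ)) (EuclideanSpace.single x (1 : ℝ)) = 0)
    (x z : ι) (φ : EuclideanSpace ℝ ι) (r : ℝ) :
    |U' (φ + r • EuclideanSpace.single z (1 : ℝ)) (EuclideanSpace.single x (1 : ℝ)) - U' φ (EuclideanSpace.single x (1 : ℝ))| ≤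
      (if b x = b z then κ₂ else 0) * |r| :=
  first_order_cross hU'd (multiblock_kernel_majorant hU''b hcross0) x z φ r

/-- The diagonal ceiling with `κd = κ₂`. [folklore] -/
theorem multiblock_ceiling (hU'd : ∀ φ : EuclideanSpace ℝ ι, HasFDerivAt U' (U'' φ) φ) (hU''b : ∀ φ : EuclideanSpace ℝ ι, ‖U'' φ‖ ≤ κ₂)
    (hcross0 : ∀ (φ : EuclideanSpace ℝ ι) (x z : ι), b z ≠ b x → U'' φ (EuclideanSpace.single z (1 : ℝ)) (EuclideanSpace.single x (1 : ℝ)) = 0)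
    (x : ι) (φ : EuclideanSpace ℝ ι) (r : ℝ) :
    |U' (φ + r • EuclideanSpace.single x (1 : ℝ)) (EuclideanSpace.single x (1 : ℝ)) - U' φ (EuclideanSpace.single x (1 : ℝ))| ≤ κ₂ * |r| :=
  first_order_ceiling hU'd (multiblock_kernel_majorant hU''b hcross0) (fun x => by simp) x φ r

/-- The diagonal floor with `lam = κ₂`. [folklore] -/
theorem multiblock_floor (hU'd : ∀ φ : EuclideanSpace ℝ ι, HasFDerivAt U' (U'' φ) φ) (hU''b : ∀ φ : EuclideanSpace ℝ ι, ‖U'' φ‖ ≤ κ₂)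
    (hcross0 : ∀ (φ : EuclideanSpace ℝ ι) (x z : ι), b z ≠ b x → U'' φ (EuclideanSpace.single z (1 : ℝ)) (EuclideanSpace.single x (1 : ℝ)) = 0)
    (x : ι) (φ : EuclideanSpace ℝ ι) (r : ℝ) :
    -κ₂ * r ^ 2 ≤ (U' (φ + r • EuclideanSpace.single x (1 : ℝ)) (EuclideanSpace.single x (1 : ℝ)) - U' φ (EuclideanSpace.single x (1 : ℝ))) * r :=
  first_order_floor hU'd (multiblock_kernel_majorant hU''b hcross0) (fun x => by simp) x φ r

/-! ## §3. Toy instance (kernel) -/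

/-- Toy: two singleton blocks on `Fin 2` (`b = id`): off the diagonal the majorant vanishes. -/
example : (if (id (0 : Fin 2)) = id (1 : Fin 2) then (1 : ℝ) else 0) = 0 := by simp

end Summit.QuantumFields.BalabanUV.T4Continuum.NE7b.SupMultiBlockFirstOrderLetters

end
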